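import Summits.HodgeConjecture.HodgeConjecture.Theorems.F0P3cStCharTSCartanDecompositionSkew   -- ★ (Q8) p851898 (F0P3-p04): `isCompl_cartan`, `exists_cartanLinearPart`, `skew_iff_tau_eq_neg`
import Summits.HodgeConjecture.HodgeConjecture.Theorems.F0P3cStCharTSAdRegularisedDescent      -- ★ C7 file 2 p851844 (LH6-p02): `det_eq_neg_discr_div_det_sq`
import Summits.HodgeConjecture.HodgeConjecture.Theorems.F0P3cStCharTSJacCartanFixedField         -- ★ (C8b-field) p852178 (LH5-p02): `exists_fixedSubfield`, `finiteDimensional_of_involutive`, `exists_fixedSubmodule_skew`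
import Summits.HodgeConjecture.HodgeConjecture.Theorems.F0P3cStCharTSJacCartanModelFrame         -- ★ (C8b-frame) p852127 (LH5-p02): `continuous_linearMap_matrix`
import Literature.MeasureTheory.Group.LocalFieldLinearJacobian                                  -- ★ C6 p851819 (LH10-p01): `addEquivAddHaarChar_continuousLinearEquiv_of_trivialization`, `…_eq_of_semiconj`, `measure_image_eq_addEquivAddHaarChar_mul`
import Literature.NumberTheory.Automorphic.LocalRingUnitModulusProduct                          -- ★ `distribHaarChar_eq_normAbs`
import Mathlib.Topology.Metrizable.Urysohn                                                      -- second-countable regular spaces are pseudo-metrisable (regularity of the product Haar measure in §1)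
import HarnessLib

/-!
# F0 · P3c · line LH6 «StCharTS» — ROAD «JAC-ELL» brick «WEIGHT-DOCK», file 1 ∕ 2 «JACOBIAN CHARACTER OF THE CARTAN LINEAR PART»:
# `χ(L) = |−disc(χ_{t₀}) ∕ det(t₀)²|_K^{1∕2}` for EVERY bi-continuous additive automorphism `L` of the skew-hermitian Lie algebra `𝔲(σ, J) ⊂ M₃(K)` that is
# the identity on `𝔷(t₀) ∩ 𝔲` and `Ad(t₀⁻¹) − 1` on `(Ad(t₀) − 1)M₃(K) ∩ 𝔲` (Harish-Chandra 1970, Lemma 22; Weil 1967, Ch. I §2; Rogawski 1990, §12.5 p. 182, §4.9 p. 54)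

Cell `pub/hodgecm-mathlib`, crux H413 = `stmt-HodgeConjecture-24833` (lane `--supports … --as helper`), route HCCMUnconditional; seat LH6-p04 (g7), DEFAULT organ
«JAC-ELL WEIGHT-DOCK★» (bus F0∕P3b 2026-09-02T17:42Z) on LH5-p02 (g6)'s road «JAC-ELL» (`F0/P3c/LH5/LH5-p02/g6/ROAD-JAC-ELL.v1.LH5p02g6.md`): the C8b-model head
`tubeJacobianLocal_elliptic_model` (sigsheet F0∕P3c 16:51:41Z) leaves the weight UNIDENTIFIED — its hypothesis `hD'val` asks, for every regular `t₀` of the compact Cartan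
`T'`, every additive subgroup `𝔲` with the skew field hypothesis and every `L : ↥𝔲 ≃ₜ+ ↥𝔲` with `L X = X` on the commutant of `t₀` and `L X = t₀⁻¹ X t₀ − X` on
`(Ad(t₀) − 1)M₃(K)`, that `(D' t₀ : ℝ≥0∞) = addEquivAddHaarChar L`.  THIS FILE computes `addEquivAddHaarChar L` in closed form at the `K`-level (no fixed field as a
topological field, no `F`-form basis): **`addEquivAddHaarChar L = √‖−disc(χ_{t₀}) ∕ det(t₀)²‖_K`** (`‖·‖_K` = ★ `normAbs K`, the module of `K`), which file 2 ∕ 2 reads as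
`(𝔇.DG t₀)²` through ★ `F0P3cStCharTSWeightIdElliptic.DG_sq_eq_sqrt` at `K = L_w` (non-split `v`, `|x|_w = |x|_K`).  THEOREMS ONLY (no definition ∕ instance ∕ notation ∕
named fact ∕ `sorry`); ★-only imports.

THE MATHEMATICS.  `K` a non-archimedean local field of characteristic `0`, `σ` a continuous involution of `K` with `σ ≠ id` (pick `θ ≠ 0` with `σ θ = −θ`), `J ∈ GL_n(K)`
HERMITIAN (`(J.map σ)ᵀ = J`), `τ(X) := J⁻¹ (X.map σ)ᵀ J` — a `σ`-semilinear INVOLUTION of `M_n(K)` (§2 `tau_tau`) with `𝔲 = {τ X = −X}` (★ `skew_iff_tau_eq_neg`) and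
`τ(θ X) = −θ τ(X)`, so **`M_n(K) = 𝔲 ⊕ θ𝔲`**: `e : ↥𝔲 × ↥𝔲 ≃ₜ+ M_n(K)`, `e(X, Y) = X + θY`, inverse `Z ↦ (½(Z − τZ), (2θ)⁻¹(Z + τZ))` (§2 `exists_skew_prodEquiv`).  For `t₀`
unitary with separable characteristic polynomial, ★ (Q8) `exists_cartanLinearPart` (over the fixed field `K^σ`, ★ C8b-field) gives the `K`-linear companion `Φ` of the
linear part (a regularised Jacobian operator: `Φ ∘ (Ad t₀ − 1) = (Ad t₀⁻¹ − 1) ∘ (Ad t₀ − 1)`, `Φ = id` on `𝔷(t₀)`), and `Φ|_𝔲 = L` because both agree on `𝔱` and on `𝔪` and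
`𝔲 = 𝔱 ⊕ 𝔪` (★ `isCompl_cartan`).  `Φ` is `K`-linear, so `Φ ∘ e = e ∘ (L × L)`; hence (★ C6 transport `addEquivAddHaarChar_eq_of_semiconj` + §1 `addEquivAddHaarChar_prod`)
**`χ(L)² = χ(L × L) = χ(Φ) = ‖det_K Φ‖_K`** (★ C6 `addEquivAddHaarChar_continuousLinearEquiv` on `M_n(K) ≃ K^{n×n}`, ★ `distribHaarChar_eq_normAbs`), and for `n = 3`
★ C7 `det_eq_neg_discr_div_det_sq` gives `det_K Φ = −disc(χ_{t₀}) ∕ det(t₀)²`.  §1 `addEquivAddHaarChar_prod`: the Haar character of `φ × ψ` on a product of second-countable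
locally compact abelian groups is `χ(φ) χ(ψ)` (evaluate the product Haar measure on a product of positive compacts; ★ C6 `measure_image_eq_addEquivAddHaarChar_mul`).
HONEST LABEL: count-neutral measure theory ∕ linear algebra for the ELLIPTIC half of the print residue «WIF» [Rogawski1990 §12.5 p. 182] of the (S-𝔇) organ; closes no organ;
HC_CM is proved only modulo the 7 printed citations (2 remaining: hLiu418 = `stmt-HodgeConjecture-24832`, h413 = `stmt-HodgeConjecture-24833`) until rung 0 closes.

## References
* [HarishChandra1970] Harish-Chandra, *Harmonic analysis on reductive p-adic groups*, LNM 162 (1970), Lemma 22 (the Jacobian `|det((1 − Ad t)|_{𝔤∕𝔱})|` of `(x, t) ↦ x t x⁻¹`).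
* [WeilBNT1967] A. Weil, *Basic Number Theory* (1967), Ch. I §2 Cor. 3 of Thm. 3 («mod_V(L) = mod_K(det L)»).
* [Rogawski1990] J. D. Rogawski, *Automorphic Representations of Unitary Groups in Three Variables*, Ann. of Math. Stud. 123 (1990), §12.5 p. 182 (Weyl integration formula),
  §4.9 p. 54 (`D_G`).
-/

set_option autoImplicit false
-- the mandated namespace has the single-problem summit's repeated segment (`HodgeConjecture.HodgeConjecture`)
set_option linter.dupNamespace false

noncomputable section

open MeasureTheory MeasureTheory.Measure Set TopologicalSpace Matrix Polynomial
open scoped ENNReal NNReal MatrixGroups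
open Literature.MeasureTheory.Group Literature.NumberTheory.GaloisRepresentations.IsNonarchimedeanLocalField
open Summit.HodgeConjecture.HodgeConjecture.Cruxes.H413.F0P3cStCharTSCartanDecompositionAd
open Summit.HodgeConjecture.HodgeConjecture.Cruxes.H413.F0P3cStCharTSCartanDecompositionSkew
open Summit.HodgeConjecture.HodgeConjecture.Cruxes.H413.F0P3cStCharTSJacCartanFixedField
open Summit.HodgeConjecture.HodgeConjecture.Cruxes.H413.F0P3cStCharTSJacCartanModelFrame (continuous_linearMap_matrix)

namespace Summit.HodgeConjecture.HodgeConjecture.Cruxes.H413.F0P3cStCharTSJacCartanWeight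

/-! ## §1 The Haar character of a product automorphism -/

section Prod

variable {A B : Type*} [AddCommGroup A] [TopologicalSpace A] [IsTopologicalAddGroup A] [MeasurableSpace A] [BorelSpace A]
  [LocallyCompactSpace A] [SecondCountableTopology A]
  [AddCommGroup B] [TopologicalSpace B] [IsTopologicalAddGroup B] [MeasurableSpace B] [BorelSpace B]
  [LocallyCompactSpace B] [SecondCountableTopology B]

/-- **`χ(φ × ψ) = χ(φ) χ(ψ)`**: the Haar character of a product `P = φ × ψ` of bi-continuous additive automorphisms of second-countable locally compact abelian groups
`A`, `B` is the product of the Haar characters (evaluate `μ_A ⊗ μ_B` on `K_A × K_B` for positive compacts and use `μ (φ '' s) = χ(φ) μ s` thrice).  `P` is any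
bi-continuous automorphism of `A × B` acting as `(a, b) ↦ (φ a, ψ b)` (no `prodCongr` constructor is posited). [cite: WeilBNT1967, Ch. I §2] -/
theorem addEquivAddHaarChar_prod (φ : A ≃ₜ+ A) (ψ : B ≃ₜ+ B) (P : (A × B) ≃ₜ+ (A × B))
    (hP : ∀ p, P p = (φ p.1, ψ p.2)) :
    addEquivAddHaarChar P = addEquivAddHaarChar φ * addEquivAddHaarChar ψ := by
  obtain ⟨KA⟩ := (inferInstance : Nonempty (PositiveCompacts A))
  obtain ⟨KB⟩ := (inferInstance : Nonempty (PositiveCompacts B))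
  have hA0 : addHaarMeasure KA (KA : Set A) ≠ 0 := by rw [addHaarMeasure_self]; exact one_ne_zero
  have hAt : addHaarMeasure KA (KA : Set A) ≠ ∞ := KA.isCompact.measure_lt_top.ne
  have hB0 : addHaarMeasure KB (KB : Set B) ≠ 0 := by rw [addHaarMeasure_self]; exact one_ne_zero
  have hBt : addHaarMeasure KB (KB : Set B) ≠ ∞ := KB.isCompact.measure_lt_top.ne
  have himg : P '' ((KA : Set A) ×ˢ (KB : Set B)) = (φ '' (KA : Set A)) ×ˢ (ψ '' (KB : Set B)) := by
    rw [← Set.prodMap_image_prod]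
    congr 1
    funext p
    exact hP p
  have h := measure_image_eq_addEquivAddHaarChar_mul ((addHaarMeasure KA).prod (addHaarMeasure KB)) P ((KA : Set A) ×ˢ (KB : Set B))
  rw [himg, Measure.prod_prod, Measure.prod_prod, measure_image_eq_addEquivAddHaarChar_mul (addHaarMeasure KA) φ,
    measure_image_eq_addEquivAddHaarChar_mul (addHaarMeasure KB) ψ] at h
  have h' : ((addEquivAddHaarChar φ * addEquivAddHaarChar ψ : ℝ≥0) : ℝ≥0∞) * (addHaarMeasure KA (KA : Set A) * addHaarMeasure KB (KB : Set B)) =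
      (addEquivAddHaarChar P : ℝ≥0∞) * (addHaarMeasure KA (KA : Set A) * addHaarMeasure KB (KB : Set B)) := by
    rw [← h, ENNReal.coe_mul]; ring
  have hne : addHaarMeasure KA (KA : Set A) * addHaarMeasure KB (KB : Set B) ≠ 0 := mul_ne_zero hA0 hB0
  have hnt : addHaarMeasure KA (KA : Set A) * addHaarMeasure KB (KB : Set B) ≠ ∞ := ENNReal.mul_ne_top hAt hBt
  exact_mod_cast ((ENNReal.mul_left_inj hne hnt).1 h').symm

end Prod

/-! ## §2 The `σ`-semilinear involution `τ(X) = J⁻¹ (X.map σ)ᵀ J` and the splitting `M_n(K) = 𝔲 ⊕ θ𝔲` -/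

section Skew

variable {K : Type*} [Field K] (σ : K →+* K) {n : Type*} [Fintype n] [DecidableEq n] (J : Matrix n n K)

omit [Fintype n] [DecidableEq n] in
/-- `(c • X).map σ = σ c • X.map σ`. [folklore] -/
theorem map_smul_eq (c : K) (X : Matrix n n K) : (c • X).map σ = σ c • X.map σ := by
  ext i j
  simp [Matrix.map_apply, Matrix.smul_apply, map_mul]

/-- `τ` is additive: `τ(X + Y) = τ X + τ Y`. [folklore] -/
theorem tau_add (X Y : Matrix n n K) :
    J⁻¹ * ((X + Y).map σ)ᵀ * J = J⁻¹ * (X.map σ)ᵀ * J + J⁻¹ * (Y.map σ)ᵀ * J := by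
  rw [Matrix.map_add σ (map_add σ), Matrix.transpose_add, Matrix.mul_add, Matrix.add_mul]

/-- `τ` is `σ`-semilinear: `τ(c • X) = σ c • τ X`. [folklore] -/
theorem tau_smul (c : K) (X : Matrix n n K) :
    J⁻¹ * ((c • X).map σ)ᵀ * J = σ c • (J⁻¹ * (X.map σ)ᵀ * J) := by
  rw [map_smul_eq, Matrix.transpose_smul, Matrix.mul_smul, Matrix.smul_mul]

/-- `τ` kills `0`-free: `τ (−X) = −τ X` and `τ (X − Y) = τ X − τ Y`. [folklore] -/
theorem tau_sub (X Y : Matrix n n K) :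
    J⁻¹ * ((X - Y).map σ)ᵀ * J = J⁻¹ * (X.map σ)ᵀ * J - J⁻¹ * (Y.map σ)ᵀ * J := by
  rw [Matrix.map_sub σ (map_sub σ), Matrix.transpose_sub, Matrix.mul_sub, Matrix.sub_mul]

/-- **`τ` is an involution** for `σ` an involution and `J` hermitian invertible: `J⁻¹ ((J⁻¹ (X.map σ)ᵀ J).map σ)ᵀ J = X` (`((J⁻¹).map σ)ᵀ = J⁻¹` since
`((J⁻¹).map σ)ᵀ (J.map σ)ᵀ = ((J J⁻¹).map σ)ᵀ = 1` and `(J.map σ)ᵀ = J`). [cite: PlatonovRapinchuk1994, §3.3] -/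
theorem tau_tau (hJ : IsUnit J.det) (hJh : (J.map σ)ᵀ = J) (hσ2 : ∀ a, σ (σ a) = a) (X : Matrix n n K) :
    J⁻¹ * ((J⁻¹ * (X.map σ)ᵀ * J).map σ)ᵀ * J = X := by
  have hXσσ : ((X.map σ)ᵀ.map σ)ᵀ = X := by
    rw [Matrix.transpose_map, Matrix.transpose_transpose]
    ext i j; simp [Matrix.map_apply, hσ2]
  have hinvσ : ((J⁻¹).map σ)ᵀ = J⁻¹ := by
    have h1 : ((J⁻¹).map σ)ᵀ * (J.map σ)ᵀ = 1 := by
      rw [← Matrix.transpose_mul, ← Matrix.map_mul, Matrix.mul_nonsing_inv J hJ, Matrix.map_one σ (map_zero σ) (map_one σ), Matrix.transpose_one]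
    rw [hJh] at h1
    exact (Matrix.inv_eq_left_inv h1).symm
  have hJJ : J⁻¹ * J = 1 := Matrix.nonsing_inv_mul J hJ
  rw [Matrix.map_mul, Matrix.map_mul, Matrix.transpose_mul, Matrix.transpose_mul, hXσσ, hJh, hinvσ]
  calc J⁻¹ * (J * (X * J⁻¹)) * J = (J⁻¹ * J) * X * (J⁻¹ * J) := by noncomm_ring
    _ = X := by rw [hJJ, Matrix.one_mul, Matrix.mul_one]

variable [TopologicalSpace K] [IsTopologicalRing K]

omit [Fintype n] [DecidableEq n] [IsTopologicalRing K] in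
/-- `X ↦ X.map σ` is continuous on `M_n(K)` for continuous `σ`. [folklore] -/
theorem continuous_map_matrix (hσc : Continuous σ) : Continuous fun X : Matrix n n K => X.map σ :=
  continuous_id.matrix_map hσc

/-- **`M_n(K) = 𝔲 ⊕ θ𝔲` as topological groups.**  For a continuous involution `σ` of the topological field `K` (`2 ≠ 0`), `θ ≠ 0` with `σ θ = −θ`, and `J`
hermitian invertible, the additive subgroup `𝔲 = {X | (X.map σ)ᵀ J + J X = 0}` (field hypothesis) satisfies: `(X, Y) ↦ X + θ Y` is a bi-continuous additive
isomorphism `↥𝔲 × ↥𝔲 ≃ₜ+ M_n(K)` (inverse `Z ↦ (½(Z − τZ), (2θ)⁻¹(Z + τZ))`, `τ Z = J⁻¹ (Z.map σ)ᵀ J`).  Stated as an existence (no definition posited).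
[cite: PlatonovRapinchuk1994, §3.3] -/
theorem exists_skew_prodEquiv (hσc : Continuous σ) (hσ2 : ∀ a, σ (σ a) = a) (h2 : (2 : K) ≠ 0) {θ : K} (hθ : θ ≠ 0) (hθσ : σ θ = -θ)
    (hJ : IsUnit J.det) (hJh : (J.map σ)ᵀ = J)
    (𝔲 : AddSubgroup (Matrix n n K)) (h𝔲 : ∀ X, X ∈ 𝔲 ↔ (X.map σ)ᵀ * J + J * X = 0) :
    ∃ e : (↥𝔲 × ↥𝔲) ≃ₜ+ Matrix n n K, ∀ p, e p = (p.1 : Matrix n n K) + θ • (p.2 : Matrix n n K) := by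
  -- membership in `𝔲` = `τ X = −X`
  have hmem : ∀ X : Matrix n n K, X ∈ 𝔲 ↔ J⁻¹ * (X.map σ)ᵀ * J = -X := fun X => (h𝔲 X).trans (skew_iff_tau_eq_neg σ J hJ X)
  have hσ2' : σ 2 = 2 := by rw [← one_add_one_eq_two, map_add, map_one]
  have h2θ : (2 : K) * θ ≠ 0 := mul_ne_zero h2 hθ
  -- the two components of the inverse
  have hodd : ∀ Z : Matrix n n K, (2 : K)⁻¹ • (Z - J⁻¹ * (Z.map σ)ᵀ * J) ∈ 𝔲 := by
    intro Z
    rw [hmem, tau_smul, tau_sub, tau_tau σ J hJ hJh hσ2, map_inv₀, hσ2', ← smul_neg, neg_sub]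
  have heven : ∀ Z : Matrix n n K, ((2 : K) * θ)⁻¹ • (Z + J⁻¹ * (Z.map σ)ᵀ * J) ∈ 𝔲 := by
    intro Z
    rw [hmem, tau_smul, tau_add, tau_tau σ J hJ hJh hσ2, map_inv₀, map_mul, hσ2', hθσ, mul_neg, inv_neg, neg_smul, add_comm]
  -- the algebraic equivalence
  let E : (↥𝔲 × ↥𝔲) ≃+ Matrix n n K :=
    { toFun := fun p => (p.1 : Matrix n n K) + θ • (p.2 : Matrix n n K)
      invFun := fun Z => (⟨(2 : K)⁻¹ • (Z - J⁻¹ * (Z.map σ)ᵀ * J), hodd Z⟩, ⟨((2 : K) * θ)⁻¹ • (Z + J⁻¹ * (Z.map σ)ᵀ * J), heven Z⟩)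
      left_inv := by
        rintro ⟨⟨X, hX⟩, ⟨Y, hY⟩⟩
        have hX' := (hmem X).1 hX
        have hY' := (hmem Y).1 hY
        have hτ : J⁻¹ * ((X + θ • Y).map σ)ᵀ * J = -X + θ • Y := by
          rw [tau_add, tau_smul, hX', hY', hθσ, neg_smul, smul_neg, neg_neg]
        refine Prod.ext (Subtype.ext ?_) (Subtype.ext ?_)
        · show (2 : K)⁻¹ • ((X + θ • Y) - J⁻¹ * ((X + θ • Y).map σ)ᵀ * J) = X
          rw [hτ, show X + θ • Y - (-X + θ • Y) = (2 : K) • X by rw [two_smul]; abel, smul_smul, inv_mul_cancel₀ h2, one_smul]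
        · show ((2 : K) * θ)⁻¹ • ((X + θ • Y) + J⁻¹ * ((X + θ • Y).map σ)ᵀ * J) = Y
          rw [hτ, show X + θ • Y + (-X + θ • Y) = ((2 : K) * θ) • Y by rw [mul_smul, two_smul]; abel, smul_smul, inv_mul_cancel₀ h2θ,
            one_smul]
      right_inv := by
        intro Z
        show (2 : K)⁻¹ • (Z - J⁻¹ * (Z.map σ)ᵀ * J) + θ • (((2 : K) * θ)⁻¹ • (Z + J⁻¹ * (Z.map σ)ᵀ * J)) = Z
        have hc : θ * ((2 : K) * θ)⁻¹ = (2 : K)⁻¹ := by field_simp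
        rw [smul_smul, hc, ← smul_add, show Z - J⁻¹ * (Z.map σ)ᵀ * J + (Z + J⁻¹ * (Z.map σ)ᵀ * J) = (2 : K) • Z by
          rw [two_smul]; abel, smul_smul, inv_mul_cancel₀ h2, one_smul]
      map_add' := by
        rintro ⟨⟨X, hX⟩, ⟨Y, hY⟩⟩ ⟨⟨X', hX'⟩, ⟨Y', hY'⟩⟩
        show (X + X') + θ • (Y + Y') = (X + θ • Y) + (X' + θ • Y')
        rw [smul_add]; abel }
  -- continuity of `τ`
  have hτc : Continuous fun Z : Matrix n n K => J⁻¹ * (Z.map σ)ᵀ * J :=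
    ((continuous_const.mul ((continuous_map_matrix σ hσc).matrix_transpose)).mul continuous_const)
  refine ⟨{ E with
      continuous_toFun := ?_
      continuous_invFun := ?_ }, fun p => rfl⟩
  · show Continuous fun p : ↥𝔲 × ↥𝔲 => (p.1 : Matrix n n K) + θ • (p.2 : Matrix n n K)
    fun_prop
  · show Continuous fun Z : Matrix n n K =>
      ((⟨(2 : K)⁻¹ • (Z - J⁻¹ * (Z.map σ)ᵀ * J), hodd Z⟩ : ↥𝔲), (⟨((2 : K) * θ)⁻¹ • (Z + J⁻¹ * (Z.map σ)ᵀ * J), heven Z⟩ : ↥𝔲))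
    have hc1 : Continuous fun Z : Matrix n n K => (2 : K)⁻¹ • (Z - J⁻¹ * (Z.map σ)ᵀ * J) := by fun_prop
    have hc2 : Continuous fun Z : Matrix n n K => ((2 : K) * θ)⁻¹ • (Z + J⁻¹ * (Z.map σ)ᵀ * J) := by fun_prop
    exact (hc1.subtype_mk hodd).prodMk (hc2.subtype_mk heven)

end Skew

/-! ## §3 The Haar character of the Cartan linear part: `χ(L)² = ‖det_K Φ‖_K` and, for `n = 3`, `χ(L) = √‖−disc(χ_{t₀}) ∕ det(t₀)²‖_K` -/

section Main

variable {K : Type*} [Field K] [ValuativeRel K] [TopologicalSpace K] [IsNonarchimedeanLocalField K] [CharZero K] [SecondCountableTopology K]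
  {n : Type*} [Fintype n] [DecidableEq n]

/-- **`χ(L)² = ‖det_K Φ‖_K`** (any `n`).  `σ` a continuous involution of the non-archimedean local field `K` (characteristic `0`) with `σ ≠ id`, `J` hermitian invertible,
`t₀ ∈ GL_n(K)` unitary with separable characteristic polynomial, `𝔲` the skew additive subgroup (field hypothesis) with any Borel structure making it a locally compact
measurable group, `L : ↥𝔲 ≃ₜ+ ↥𝔲` the identity on `𝔷(t₀) ∩ 𝔲` and `X ↦ t₀⁻¹ X t₀ − X` on `(Ad(t₀) − 1)M_n(K) ∩ 𝔲` (the two laws of ★ `tubeJacobianLocal_elliptic_model`'s `hDval`),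
and `Φ` ANY `K`-linear regularised Jacobian operator (`Φ ∘ (Ad t₀ − 1) = (Ad t₀⁻¹ − 1) ∘ (Ad t₀ − 1)`, `Φ = id` on `𝔷(t₀)`): then `Φ|_𝔲 = L` (★ `isCompl_cartan` over the fixed
field), `Φ ∘ e = e ∘ (L × L)` for the splitting `e : ↥𝔲 × ↥𝔲 ≃ₜ+ M_n(K)` of §2, and `(addEquivAddHaarChar L)² = χ(L × L) = χ(Φ) = ‖det_K Φ‖_K` (§1, ★ C6, ★ `distribHaarChar_eq_normAbs`).
[cite: HarishChandra1970, Lemma 22] [cite: WeilBNT1967, Ch. I §2] -/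
theorem addEquivAddHaarChar_sq_eq_normAbs_det (σ : K →+* K) (hσc : Continuous σ) (hσ2 : ∀ a, σ (σ a) = a) (hσne : ∃ a, σ a ≠ a)
    (J : Matrix n n K) (hJ : IsUnit J.det) (hJh : (J.map σ)ᵀ = J)
    (t₀ : GL n K) (ht₀ : ((t₀ : Matrix n n K).map σ)ᵀ * J * (t₀ : Matrix n n K) = J) (hsep : (t₀ : Matrix n n K).charpoly.Separable)
    (𝔲 : AddSubgroup (Matrix n n K)) [MeasurableSpace ↥𝔲] [BorelSpace ↥𝔲] [LocallyCompactSpace ↥𝔲]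
    (h𝔲 : ∀ X, X ∈ 𝔲 ↔ (X.map σ)ᵀ * J + J * X = 0)
    (L : ↥𝔲 ≃ₜ+ ↥𝔲)
    (hLt : ∀ X : ↥𝔲, (X : Matrix n n K) * (t₀ : Matrix n n K) = (t₀ : Matrix n n K) * X → L X = X)
    (hLm : ∀ (X : ↥𝔲) (Y : Matrix n n K), (X : Matrix n n K) = (t₀ : Matrix n n K) * Y * ((t₀⁻¹ : GL n K) : Matrix n n K) - Y →
      ((L X : ↥𝔲) : Matrix n n K) = ((t₀⁻¹ : GL n K) : Matrix n n K) * X * (t₀ : Matrix n n K) - X)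
    (Φ : Matrix n n K →ₗ[K] Matrix n n K)
    (h1 : Φ ∘ₗ (LinearMap.mulLeftRight K ((t₀ : Matrix n n K), ((t₀⁻¹ : GL n K) : Matrix n n K)) - LinearMap.id) =
      (LinearMap.mulLeftRight K (((t₀⁻¹ : GL n K) : Matrix n n K), (t₀ : Matrix n n K)) - LinearMap.id) ∘ₗ
        (LinearMap.mulLeftRight K ((t₀ : Matrix n n K), ((t₀⁻¹ : GL n K) : Matrix n n K)) - LinearMap.id))
    (h2 : ∀ Z : Matrix n n K, Z * (t₀ : Matrix n n K) = (t₀ : Matrix n n K) * Z → Φ Z = Z) :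
    (addEquivAddHaarChar L) ^ 2 = normAbs K (LinearMap.det Φ) := by
  classical
  have h2K : (2 : K) ≠ 0 := two_ne_zero
  -- `θ ≠ 0` with `σ θ = −θ`
  obtain ⟨a, ha⟩ := hσne
  have hθ : a - σ a ≠ 0 := sub_ne_zero.2 (Ne.symm ha)
  have hθσ : σ (a - σ a) = -(a - σ a) := by rw [map_sub, hσ2, neg_sub]
  -- the splitting `e : ↥𝔲 × ↥𝔲 ≃ₜ+ M_n(K)`, `e (X, Y) = X + θ Y`
  obtain ⟨e, he⟩ := exists_skew_prodEquiv σ J hσc hσ2 h2K hθ hθσ hJ hJh 𝔲 h𝔲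
  -- `Φ|_𝔲 = L`: decompose inside `𝔲` over the fixed field (★ `isCompl_cartan`)
  obtain ⟨F, hF⟩ := exists_fixedSubfield σ
  obtain ⟨𝔲F, h𝔲F⟩ := exists_fixedSubmodule_skew σ J F hF
  have hc := isCompl_cartan σ J hJ 𝔲F h𝔲F t₀ ht₀ hsep
  have hΦL : ∀ X : ↥𝔲, Φ (X : Matrix n n K) = ((L X : ↥𝔲) : Matrix n n K) := by
    intro X
    have hXF : (X : Matrix n n K) ∈ 𝔲F := (h𝔲F _).2 ((h𝔲 _).1 X.2)
    have htop : (⟨(X : Matrix n n K), hXF⟩ : ↥𝔲F) ∈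
        (((LinearMap.ker (LinearMap.mulLeftRight K ((t₀ : Matrix n n K), ((t₀⁻¹ : GL n K) : Matrix n n K)) - LinearMap.id : Matrix n n K →ₗ[K] Matrix n n K)).restrictScalars ↥F).comap 𝔲F.subtype) ⊔
        (((LinearMap.range (LinearMap.mulLeftRight K ((t₀ : Matrix n n K), ((t₀⁻¹ : GL n K) : Matrix n n K)) - LinearMap.id : Matrix n n K →ₗ[K] Matrix n n K)).restrictScalars ↥F).comap 𝔲F.subtype) := by
      rw [hc.sup_eq_top]; exact Submodule.mem_top
    obtain ⟨u, hu, w, hw, huw⟩ := Submodule.mem_sup.1 htop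
    rw [Submodule.mem_comap, Submodule.restrictScalars_mem, Submodule.subtype_apply] at hu hw
    -- `u` commutes with `t₀`; `w = t₀ Y t₀⁻¹ − Y`
    have hu' : (u : Matrix n n K) * (t₀ : Matrix n n K) = (t₀ : Matrix n n K) * u := (mem_ker_adSubOne_iff t₀ _).1 hu
    obtain ⟨Y, hY⟩ := LinearMap.mem_range.1 hw
    have hY' : (w : Matrix n n K) = (t₀ : Matrix n n K) * Y * ((t₀⁻¹ : GL n K) : Matrix n n K) - Y := by
      rw [← hY, LinearMap.sub_apply, LinearMap.mulLeftRight_apply, LinearMap.id_apply]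
    -- the same decomposition inside `↥𝔲`
    let u' : ↥𝔲 := ⟨(u : Matrix n n K), (h𝔲 _).2 ((h𝔲F _).1 u.2)⟩
    let w' : ↥𝔲 := ⟨(w : Matrix n n K), (h𝔲 _).2 ((h𝔲F _).1 w.2)⟩
    have hX : X = u' + w' := by
      apply Subtype.ext
      have h := congrArg (fun Z : ↥𝔲F => (Z : Matrix n n K)) huw
      simp only [Submodule.coe_add] at h
      exact h.symm
    have hLu : L u' = u' := hLt u' hu'
    have hLw : ((L w' : ↥𝔲) : Matrix n n K) = ((t₀⁻¹ : GL n K) : Matrix n n K) * w * (t₀ : Matrix n n K) - w := hLm w' Y hY'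
    have hΦu : Φ (u : Matrix n n K) = u := h2 _ hu'
    have hΦw : Φ (w : Matrix n n K) = ((t₀⁻¹ : GL n K) : Matrix n n K) * w * (t₀ : Matrix n n K) - w := by
      have h := LinearMap.congr_fun h1 Y
      simp only [LinearMap.comp_apply, LinearMap.sub_apply, LinearMap.mulLeftRight_apply, LinearMap.id_apply] at h
      rw [hY', h]
    rw [hX, map_add, AddSubgroup.coe_add, AddSubgroup.coe_add, map_add, hLu, hLw]
    show Φ (u : Matrix n n K) + Φ (w : Matrix n n K) = _
    rw [hΦu, hΦw]
  -- second countability of `M_n(K)` and of `𝔲` (Borel structure of the product `↥𝔲 × ↥𝔲`)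
  haveI : SecondCountableTopology (Matrix n n K) := inferInstanceAs (SecondCountableTopology (n → n → K))
  haveI : SecondCountableTopology ↥𝔲 := TopologicalSpace.Subtype.secondCountableTopology _
  -- the product automorphism `P = L × L`
  let P : (↥𝔲 × ↥𝔲) ≃ₜ+ (↥𝔲 × ↥𝔲) :=
    { AddEquiv.prodCongr L.toAddEquiv L.toAddEquiv with
      continuous_toFun := by
        show Continuous fun p : ↥𝔲 × ↥𝔲 => (L p.1, L p.2)
        fun_prop
      continuous_invFun := by
        show Continuous fun p : ↥𝔲 × ↥𝔲 => (L.symm p.1, L.symm p.2)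
        fun_prop }
  have hP : ∀ p, P p = (L p.1, L p.2) := fun p => rfl
  have hprod : addEquivAddHaarChar P = addEquivAddHaarChar L * addEquivAddHaarChar L := addEquivAddHaarChar_prod L L P hP
  -- `Φ` as a function is `e ∘ P ∘ e⁻¹`
  let ΦL : Matrix n n K ≃ₜ+ Matrix n n K := (e.symm.trans P).trans e
  have hsemi : ∀ x, e (P x) = ΦL (e x) := fun x => by
    show e (P x) = e (P (e.symm (e x)))
    rw [ContinuousAddEquiv.symm_apply_apply]
  have hfun : ∀ Z, Φ Z = ΦL Z := by
    intro Z
    obtain ⟨p, rfl⟩ := e.surjective Z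
    rw [← hsemi, he, he, hP, map_add, map_smul, hΦL, hΦL]
  -- Borel structures on `K` and `M_n(K)`
  borelize K
  letI : MeasurableSpace (Matrix n n K) := borel _
  haveI : BorelSpace (Matrix n n K) := ⟨rfl⟩
  haveI : LocallyCompactSpace (Matrix n n K) := inferInstanceAs (LocallyCompactSpace (n → n → K))
  have hχ : addEquivAddHaarChar P = addEquivAddHaarChar ΦL := addEquivAddHaarChar_eq_of_semiconj e P ΦL hsemi
  -- `Φ` as a continuous `K`-linear automorphism
  have hbij : Function.Bijective Φ := by
    rw [show (Φ : Matrix n n K → Matrix n n K) = ΦL from funext hfun]; exact ΦL.bijective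
  let ΦK : Matrix n n K ≃L[K] Matrix n n K :=
    { LinearEquiv.ofBijective Φ hbij with
      continuous_toFun := continuous_linearMap_matrix Φ
      continuous_invFun := continuous_linearMap_matrix ((LinearEquiv.ofBijective Φ hbij).symm : Matrix n n K →ₗ[K] Matrix n n K) }
  have hΦK : ΦK.toContinuousAddEquiv = ΦL := by
    apply ContinuousAddEquiv.ext
    intro Z
    exact hfun Z
  -- the trivialisation `M_n(K) ≃L[K] K^{n × n}`
  let eM : Matrix n n K ≃L[K] (n × n → K) :=
    { toFun := fun Z p => Z p.1 p.2
      invFun := fun v => Matrix.of fun i j => v (i, j)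
      map_add' := fun _ _ => rfl
      map_smul' := fun _ _ => rfl
      left_inv := fun _ => rfl
      right_inv := fun _ => rfl
      continuous_toFun := continuous_pi fun p => (continuous_apply p.2).comp (continuous_apply p.1)
      continuous_invFun := continuous_matrix fun i j => continuous_apply (i, j) }
  have hC6 := addEquivAddHaarChar_continuousLinearEquiv_of_trivialization eM ΦK
  rw [hΦK, Literature.NumberTheory.Automorphic.UnitaryGroup.distribHaarChar_eq_normAbs, LinearEquiv.coe_det] at hC6
  rw [sq, ← hprod, hχ, hC6]
  rfl

/-- **THE JACOBIAN CHARACTER OF THE CARTAN LINEAR PART, `n = 3`: `addEquivAddHaarChar L = √‖−disc(χ_{t₀}) ∕ det(t₀)²‖_K`.**  Same hypotheses as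
`addEquivAddHaarChar_sq_eq_normAbs_det` without `Φ` (the companion exists by ★ (Q8) `exists_cartanLinearPart` over the fixed field, and ★ C7 `det_eq_neg_discr_div_det_sq`
computes its determinant).  This is the value the consumer of ★ `F0P3cStCharTSJacCartanElliptic.tubeJacobianLocal_elliptic_model` must supply for `hDval` (file 2 ∕ 2 reads the
right-hand side as `(𝔇.DG t₀)²`). [cite: HarishChandra1970, Lemma 22] [cite: WeilBNT1967, Ch. I §2] [cite: Rogawski1990, §12.5 p. 182; §4.9 p. 54] -/
theorem addEquivAddHaarChar_eq_sqrt_normAbs (σ : K →+* K) (hσc : Continuous σ) (hσ2 : ∀ a, σ (σ a) = a) (hσne : ∃ a, σ a ≠ a)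
    (J : Matrix (Fin 3) (Fin 3) K) (hJ : IsUnit J.det) (hJh : (J.map σ)ᵀ = J)
    (t₀ : GL (Fin 3) K) (ht₀ : ((t₀ : Matrix (Fin 3) (Fin 3) K).map σ)ᵀ * J * (t₀ : Matrix (Fin 3) (Fin 3) K) = J)
    (hsep : (t₀ : Matrix (Fin 3) (Fin 3) K).charpoly.Separable)
    (𝔲 : AddSubgroup (Matrix (Fin 3) (Fin 3) K)) [MeasurableSpace ↥𝔲] [BorelSpace ↥𝔲] [LocallyCompactSpace ↥𝔲]
    (h𝔲 : ∀ X, X ∈ 𝔲 ↔ (X.map σ)ᵀ * J + J * X = 0)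
    (L : ↥𝔲 ≃ₜ+ ↥𝔲)
    (hLt : ∀ X : ↥𝔲, (X : Matrix (Fin 3) (Fin 3) K) * (t₀ : Matrix (Fin 3) (Fin 3) K) = (t₀ : Matrix (Fin 3) (Fin 3) K) * X → L X = X)
    (hLm : ∀ (X : ↥𝔲) (Y : Matrix (Fin 3) (Fin 3) K),
      (X : Matrix (Fin 3) (Fin 3) K) = (t₀ : Matrix (Fin 3) (Fin 3) K) * Y * ((t₀⁻¹ : GL (Fin 3) K) : Matrix (Fin 3) (Fin 3) K) - Y →
      ((L X : ↥𝔲) : Matrix (Fin 3) (Fin 3) K) = ((t₀⁻¹ : GL (Fin 3) K) : Matrix (Fin 3) (Fin 3) K) * X * (t₀ : Matrix (Fin 3) (Fin 3) K) - X) :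
    addEquivAddHaarChar L =
      NNReal.sqrt (normAbs K (-((t₀ : Matrix (Fin 3) (Fin 3) K).charpoly.discr) / ((t₀ : Matrix (Fin 3) (Fin 3) K).det) ^ 2)) := by
  have h2K : (2 : K) ≠ 0 := two_ne_zero
  obtain ⟨F, hF⟩ := exists_fixedSubfield σ
  haveI := finiteDimensional_of_involutive σ h2K hσ2 F hF
  obtain ⟨𝔲F, h𝔲F⟩ := exists_fixedSubmodule_skew σ J F hF
  obtain ⟨_, _, Φ, -, -, -, -, h1, h2⟩ := exists_cartanLinearPart σ J hJ 𝔲F h𝔲F t₀ ht₀ hsep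
  rw [← NNReal.sqrt_sq (addEquivAddHaarChar L),
    addEquivAddHaarChar_sq_eq_normAbs_det σ hσc hσ2 hσne J hJ hJh t₀ ht₀ hsep 𝔲 h𝔲 L hLt hLm Φ h1 h2,
    F0P3cStCharTSAdRegularisedDescent.det_eq_neg_discr_div_det_sq t₀ hsep Φ h1 h2]

end Main

end Summit.HodgeConjecture.HodgeConjecture.Cruxes.H413.F0P3cStCharTSJacCartanWeight

end
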